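import Summits.Ventures.GridStability.Models.StructurePreservingInvariant
import Summits.Ventures.GridStability.Lyapunov.StructurePreservingPolytope
import HarnessLib

/-!
# GridStability/Lyapunov/StructurePreservingFaceBound — truncated potentials and PER-FACE lower bounds of
# the Bergen–Hill potential energy on the faces `δᵢ − δⱼ = ±π/2` of the angle window (structure-preserving
# model; the data of the per-face sublevel theorem `StructurePreservingFaceRoa.lean`)

Cell `gridfusion`, line G2-SCALE (BRIEF-GRIDFUSION-G2SCALE §1 question Q1, level piece); object T1 of the
lead's TYPING ORDER (cell STATUS §10, 2026-08-28) = support P1 of idea card «idea-3 /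
face-local-level-certificates» (HOME/IDEAS-G2.md, REV 3, card sha16 cde2b5ff4cd8b76a; crit-1's readings
STATUS l.10127, l.10179); typed by gridfusion-lit-4 (g14).  0 kit, 0 named facts, no `decide`.

THE CARD'S MOVE 2 (monotone truncation to a support): the potential `W = ½ Σᵢ Σⱼ bᵢⱼ·U` is a sum of terms
`≥ 0` on the CLOSED window (model-2's `branchEnergy_nonneg`), so for ANY set `S` of ordered pairs the
`S`-truncated potential is `≤ W` there, and a lower bound of a truncated potential on a face
`{δ | δᵢ − δⱼ = +π/2}` of the closed window is a lower bound of `W` on that face («inf_F V ≥ inf_{F ∩ W̄_S}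
Σ_{K ⊆ S} V_K, because dropped terms are ≥ 0 on W̄»); the support `S = {e}` gives the closed form
`m_e^± = b_e·U(a_e, ±π/2 − a_e)`.  Ordered pairs index both signs of the card's faces `F_e^±`: the face
`δᵢ − δⱼ = −π/2` is the face `δⱼ − δᵢ = +π/2` of `(j, i)`.

## Contents (all PROVED; MODELLED column — statements about MODEL MV-3, model-2's `Params`)
* §1 `truncatedPotential p S δ₀ δ = ½ Σ_{(i,j) ∈ S} bᵢⱼ·branchEnergy(δᵢ − δⱼ, δ₀ᵢ − δ₀ⱼ)` (`S = univ ×ˢ univ` is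
  model-2's `potential`); `W_S ≤ W` on the closed window (`truncatedPotential_le_potential`), monotone in `S`;
  `W_{{(i,j),(j,i)}} = bᵢⱼ·U` (`truncatedPotential_pair`).
* §2 `IsFaceBound p δ₀ m`: for every coupled ordered pair `(i, j)` and every angle vector `δ` of the CLOSED
  window with `δᵢ − δⱼ = π/2`, `m i j ≤ W(δ, δ₀)` (card P1's «`m i j ≤` a certified lower bound of inf over
  `F_ij^±` of the S-truncated potential»).  Constructors: `isFaceBound_of_truncated` (the interface for the
  card's KVL-local cycle certificates, object T2), `isFaceBound_closedForm`
  (`m i j = bᵢⱼ·branchEnergy(π/2, δ₀ᵢ − δ₀ⱼ)`), `IsFaceBound.mono`, and `isFaceBound_levelBound` (lyap-1's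
  uniform threshold `levelBound θ β` is the constant face bound — model-2's `branch_abs_lt_of_energy_le` read
  contrapositively at a face point).
THREE COLUMNS: no certificate here (an instance's numbers `m i j` are Bench data); MODELLED: MV-3 (lossless
network-preserving classical machines + frequency-dependent loads, constant `|V|` absorbed in `bᵢⱼ`); no sentence here says a grid
is stable.  Sources: [cite: Padiyar2013, §3.2 eqs (3.11)–(3.13)] (energy function, via model-2's files); the
face minima `V_min` are [cite: VuTuritsyn2017, §IV-A] in the tree's bib (the card reads the TPWRS 2016 version,
arXiv:1409.1889 §IV-B/C).
-/

noncomputable section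

open Set Filter Topology Real
open Summit.Ventures.GridStability.Models.StructurePreserving
open Summit.Ventures.GridStability.Models.StructurePreserving.Params

namespace Summit.Ventures.GridStability.Lyapunov.StructurePreserving

variable {n : ℕ}

/-! ### §1 Truncated potentials (the card's Move 2: monotone truncation to a support) -/

/-- THE `S`-TRUNCATED POTENTIAL ENERGY for a set `S` of ORDERED bus pairs:
`W_S(δ, δ₀) = ½ Σ_{(i,j) ∈ S} bᵢⱼ·branchEnergy(δᵢ − δⱼ, δ₀ᵢ − δ₀ⱼ)` — model-2's `potential` with the double
sum restricted to `S` (so `W_{univ ×ˢ univ} = W`; an unordered branch `{i, j}` contributes its full term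
`bᵢⱼ·U` when both `(i, j)` and `(j, i)` lie in `S`).  Card idea-3 § Mechanism, Move 2 («for ANY edge subset
S ∋ e, inf_F V ≥ inf Σ_{K ⊆ S} V_K»).  MODELLED (MV-3). [cite: Padiyar2013, §3.2 eqs (3.12)–(3.13)] -/
def truncatedPotential (p : Params n) (S : Finset (Fin n × Fin n)) (δ₀ δ : Fin n → ℝ) : ℝ :=
  (1 / 2) * ∑ e ∈ S, p.b e.1 e.2 * branchEnergy (δ e.1 - δ e.2) (δ₀ e.1 - δ₀ e.2)

/-- The full double sum is the potential: `W_{univ ×ˢ univ} = W`. [folklore] -/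
theorem truncatedPotential_univ (p : Params n) (δ₀ δ : Fin n → ℝ) :
    truncatedPotential p (Finset.univ ×ˢ Finset.univ) δ₀ δ = p.potential δ₀ δ := by
  unfold truncatedPotential Params.potential
  rw [Finset.sum_product]

/-- On the closed window around an equilibrium inside the window, every branch term is nonnegative
(model-2's `branchEnergy_nonneg`). [cite: Padiyar2013, §3.2 eq (3.13)] -/
theorem branchTerm_nonneg (p : Params n) (hb : ∀ i j, 0 ≤ p.b i j) {δ₀ δ : Fin n → ℝ}
    (h0 : ∀ i j, p.b i j ≠ 0 → |δ₀ i - δ₀ j| ≤ π / 2)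
    (hP : ∀ i j, p.b i j ≠ 0 → |δ i - δ j| ≤ π / 2) (i j : Fin n) :
    0 ≤ p.b i j * branchEnergy (δ i - δ j) (δ₀ i - δ₀ j) := by
  by_cases hij : p.b i j = 0
  · simp [hij]
  · refine mul_nonneg (hb i j) (branchEnergy_nonneg (h0 i j hij) ?_)
    have h1 := abs_le.mp (hP i j hij)
    have h2 := abs_le.mp (h0 i j hij)
    exact abs_le.mpr ⟨by linarith [h1.1, h2.1], by linarith [h1.2, h2.2]⟩

/-- **TRUNCATION MONOTONICITY** (card Move 2): on the closed window the truncated potential is monotone in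
the support — `S ⊆ T ⇒ W_S ≤ W_T` — because dropped terms are `≥ 0`. [cite: Padiyar2013, §3.2 eq (3.13)] -/
theorem truncatedPotential_mono (p : Params n) (hb : ∀ i j, 0 ≤ p.b i j) {δ₀ δ : Fin n → ℝ}
    (h0 : ∀ i j, p.b i j ≠ 0 → |δ₀ i - δ₀ j| ≤ π / 2)
    (hP : ∀ i j, p.b i j ≠ 0 → |δ i - δ j| ≤ π / 2) {S T : Finset (Fin n × Fin n)} (hST : S ⊆ T) :
    truncatedPotential p S δ₀ δ ≤ truncatedPotential p T δ₀ δ := by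
  unfold truncatedPotential
  refine mul_le_mul_of_nonneg_left ?_ (by norm_num)
  exact Finset.sum_le_sum_of_subset_of_nonneg hST
    (fun e _ _ => branchTerm_nonneg p hb h0 hP e.1 e.2)

/-- **`W_S ≤ W` ON THE CLOSED WINDOW** for every support `S` (card Move 2: «dropped terms are ≥ 0 on W̄»).
[cite: Padiyar2013, §3.2 eqs (3.12)–(3.13)] -/
theorem truncatedPotential_le_potential (p : Params n) (hb : ∀ i j, 0 ≤ p.b i j) {δ₀ δ : Fin n → ℝ}
    (h0 : ∀ i j, p.b i j ≠ 0 → |δ₀ i - δ₀ j| ≤ π / 2)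
    (hP : ∀ i j, p.b i j ≠ 0 → |δ i - δ j| ≤ π / 2) (S : Finset (Fin n × Fin n)) :
    truncatedPotential p S δ₀ δ ≤ p.potential δ₀ δ := by
  rw [← truncatedPotential_univ]
  exact truncatedPotential_mono p hb h0 hP (by rw [Finset.univ_product_univ]; exact Finset.subset_univ _)

/-- THE SINGLE-BRANCH SUPPORT: for `i ≠ j` and symmetric couplings, `W_{{(i,j),(j,i)}}` is exactly the branch
term `bᵢⱼ·branchEnergy(δᵢ − δⱼ, δ₀ᵢ − δ₀ⱼ)` (card: «S_e = e alone gives the closed form»; evenness of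
`branchEnergy` is lyap-1's `branchEnergy_neg_neg` of `StructurePreservingPolytope.lean`).
[cite: Padiyar2013, §3.2 eq (3.13)] -/
theorem truncatedPotential_pair (p : Params n) (hsymm : ∀ i j, p.b i j = p.b j i) {i j : Fin n}
    (hij : i ≠ j) (δ₀ δ : Fin n → ℝ) :
    truncatedPotential p {(i, j), (j, i)} δ₀ δ = p.b i j * branchEnergy (δ i - δ j) (δ₀ i - δ₀ j) := by
  unfold truncatedPotential
  have hne : (i, j) ≠ (j, i) := by
    intro h
    exact hij (Prod.mk.inj h).1
  rw [Finset.sum_pair hne]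
  dsimp only
  rw [hsymm j i, show δ j - δ i = -(δ i - δ j) by ring, show δ₀ j - δ₀ i = -(δ₀ i - δ₀ j) by ring,
    branchEnergy_neg_neg]
  ring

/-! ### §2 Face bounds -/

/-- **FACE LOWER BOUNDS** (card P1's hypothesis «`m i j ≤` a certified lower bound of inf over `F_ij^±`»):
`m : Fin n → Fin n → ℝ` is a face bound for the data `p` and the equilibrium `δ₀` when, for every coupled
ordered pair `(i, j)` (`bᵢⱼ ≠ 0`) and every angle vector `δ` of the CLOSED window (`|δₖ − δₗ| ≤ π/2` on
coupled pairs) lying on the face `δᵢ − δⱼ = π/2`, `m i j ≤ W(δ, δ₀)`.  Ordered pairs index both signs of the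
card's faces `F_e^±`: the face `δᵢ − δⱼ = −π/2` is the face `δⱼ − δᵢ = +π/2` of `(j, i)`.  Only the
POTENTIAL is bounded (kinetic energy `≥ 0` and the momentum constraint can only raise the infimum of `V`).
MODELLED (MV-3). [cite: VuTuritsyn2017, §IV-A] (face minima `V_min`, arXiv:1409.1889 §IV) -/
def IsFaceBound (p : Params n) (δ₀ : Fin n → ℝ) (m : Fin n → Fin n → ℝ) : Prop :=
  ∀ i j, p.b i j ≠ 0 → ∀ δ : Fin n → ℝ, (∀ k l, p.b k l ≠ 0 → |δ k - δ l| ≤ π / 2) →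
    δ i - δ j = π / 2 → m i j ≤ p.potential δ₀ δ

/-- Weakening a face bound pointwise on coupled pairs keeps it a face bound. [folklore] -/
theorem IsFaceBound.mono {p : Params n} {δ₀ : Fin n → ℝ} {m m' : Fin n → Fin n → ℝ}
    (h : IsFaceBound p δ₀ m) (hle : ∀ i j, p.b i j ≠ 0 → m' i j ≤ m i j) : IsFaceBound p δ₀ m' :=
  fun i j hij δ hδ hface => (hle i j hij).trans (h i j hij δ hδ hface)

/-- **FACE BOUNDS FROM TRUNCATED POTENTIALS ON ARBITRARY SUPPORTS** (the interface for the card's KVL-local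
certificates, object T2): if for each coupled ordered pair a support `S i j` and a number `m i j` are given
with `m i j ≤ W_{S i j}(δ, δ₀)` for every `δ` of the closed window on the face `δᵢ − δⱼ = π/2`, then `m` is a
face bound (`W_S ≤ W` on the closed window).  Data: `bᵢⱼ ≥ 0`, equilibrium branch angles within `π/2`.
[cite: VuTuritsyn2017, §IV-A] (face minima) with [Padiyar2013] §3.2 eq (3.13) -/
theorem isFaceBound_of_truncated {p : Params n} (hb : ∀ i j, 0 ≤ p.b i j) {δ₀ : Fin n → ℝ}
    (h0 : ∀ i j, p.b i j ≠ 0 → |δ₀ i - δ₀ j| ≤ π / 2)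
    (S : Fin n → Fin n → Finset (Fin n × Fin n)) {m : Fin n → Fin n → ℝ}
    (hm : ∀ i j, p.b i j ≠ 0 → ∀ δ : Fin n → ℝ, (∀ k l, p.b k l ≠ 0 → |δ k - δ l| ≤ π / 2) →
      δ i - δ j = π / 2 → m i j ≤ truncatedPotential p (S i j) δ₀ δ) :
    IsFaceBound p δ₀ m :=
  fun i j hij δ hδ hface =>
    (hm i j hij δ hδ hface).trans (truncatedPotential_le_potential p hb h0 hδ (S i j))

/-- **THE SINGLE-EDGE CLOSED FORM** (card: «S_e = e alone gives the closed form
`m_e^± = b_e·U(a_e, ±π/2 − a_e)`»; here `U(a, φ) = branchEnergy (a + φ) a`): for symmetric `bᵢⱼ ≥ 0` and an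
equilibrium with branch angles within `π/2`, `m i j = bᵢⱼ·branchEnergy(π/2, δ₀ᵢ − δ₀ⱼ)` is a face bound — on
the face `δᵢ − δⱼ = π/2` the branch's own term IS this constant and the other terms are `≥ 0`.
[cite: VuTuritsyn2017, §IV-A] with [Padiyar2013] §3.2 eq (3.13) -/
theorem isFaceBound_closedForm {p : Params n} (hb : ∀ i j, 0 ≤ p.b i j) (hsymm : ∀ i j, p.b i j = p.b j i)
    {δ₀ : Fin n → ℝ} (h0 : ∀ i j, p.b i j ≠ 0 → |δ₀ i - δ₀ j| ≤ π / 2) :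
    IsFaceBound p δ₀ (fun i j => p.b i j * branchEnergy (π / 2) (δ₀ i - δ₀ j)) := by
  refine isFaceBound_of_truncated hb h0 (fun i j => {(i, j), (j, i)}) (fun i j hij δ _ hface => ?_)
  have hne : i ≠ j := by
    rintro rfl
    have : (0 : ℝ) = π / 2 := by simpa using hface
    linarith [Real.pi_pos]
  show p.b i j * branchEnergy (π / 2) (δ₀ i - δ₀ j) ≤ truncatedPotential p {(i, j), (j, i)} δ₀ δ
  rw [truncatedPotential_pair p hsymm hne, hface]

/-- **THE UNIFORM THRESHOLD IS A (CONSTANT) FACE BOUND**: under the data of lyap-1's theorem (couplings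
`≥ β > 0` on edges, equilibrium branch angles `≤ θ < π/2`), `m i j = levelBound θ β` for all pairs is a face
bound — model-2's `branch_abs_lt_of_energy_le` read contrapositively at a face point (with `ω = 0`).  So
`sublevel_subset_regionOfAttraction` is the constant-`m` case of §4. [cite: VuTuritsyn2017, §IV-A] -/
theorem isFaceBound_levelBound {p : Params n} (hp : p.WellFormed) (hb : ∀ i j, 0 ≤ p.b i j) {β : ℝ}
    (hβ : 0 < β) (hβb : ∀ i j, p.couplingGraph.Adj i j → β ≤ p.b i j)
    {δ₀ : Fin n → ℝ} {θ : ℝ} (hθ0 : 0 ≤ θ) (hθ : θ < π / 2)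
    (h0 : ∀ i j, p.b i j ≠ 0 → |δ₀ i - δ₀ j| ≤ θ) :
    IsFaceBound p δ₀ (fun _ _ => levelBound θ β) := by
  intro i j hij δ hδ hface
  by_contra hlt
  rw [not_le] at hlt
  -- with `ω = 0` the energy is the potential; a level below the threshold forces a STRICT window
  have hV : p.energy δ₀ δ 0 ≤ p.potential δ₀ δ := by
    unfold Params.energy Params.kinetic
    simp
  have hc : p.potential δ₀ δ < (1 - Real.sin θ) / (π / 2 - θ) * β * (π / 2 - θ) ^ 2 / 4 := by
    simpa only [levelBound] using hlt
  have hstrict := branch_abs_lt_of_energy_le hp hb hβ hβb hθ0 hθ h0 hδ hV hc i j hij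
  rw [hface, abs_of_pos (by positivity : (0 : ℝ) < π / 2)] at hstrict
  exact lt_irrefl _ hstrict

end Summit.Ventures.GridStability.Lyapunov.StructurePreserving

end
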